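import Mathlib
import HarnessLib
import Summits.HubbardSuperconductivity.HubbardSuperconductivity.Theorems.KLProgrammeKLRegimeEngineScaleZeroV17FRaise
import Summits.HubbardSuperconductivity.HubbardSuperconductivity.Theorems.KLProgrammeKLRegimeEngineValueClausesV17FRaise
import Summits.HubbardSuperconductivity.HubbardSuperconductivity.Theorems.KLProgrammeKLRegimeEngineV8DefsU10
import Summits.HubbardSuperconductivity.HubbardSuperconductivity.Theorems.KLProgrammeKLRegimeEngineV8DefsL4

/-!
# Stub (a) `stub_engine_scale0` of the K3 ENGINE-FLOW child (stmt-HubbardSuperconductivity-20437) — RAISE-GENERIC IN BOTH PACKAGES: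
# geometry `klEngGeo8.raise T E` (any `T E`), engine constants any raise `Q` of `klEngQ7 P R`
# (cell gate-hubbard-kl, seat hubbard-kl-k3c2-p1 g7, row «scale-0 Gram step `stub_engine_scale0`»; plan g19 (R59g)/(R59h)/(R59m): the well-foundedness
# ledger for the contingent token #22 lists the (a) leg as «reads CF monotonically, lifts — 5-line transport at filing»; this file lands that transport now,
# so the (a) leg is G-generic like the (M) leg `stub_twoLeg_scale0_raise_G`, p556901)

The five scale-`0` clauses read the geometry package `G` through `initDevBar`/`legDressBarQ2` ((E2-F2)₀, (E2′-F UV)₀: untouched by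
`GeoConsts.raise`), `cE4` ((E4)₀: monotone) and `CF` ((E5-F)₀: monotone); (E1-v4)₀ does not read `G`.  Hence (k3c2-p2's …ValueClausesV17FRaise
+ …SplitGeoRaise doors):

* §1 `scaleZeroConjV17F2_raise_of` — the five-clause conclusion of stub (a) at `(G, Q)` transports to `(G.raise T E, Q)` for ANY `G T E` (`0 ≤ P.Klam`);
* §2 **`stub_engine_scale0_raise_GQ`** — stub (a) at `(klEngGeo8.raise T E, QT P R)` for any `T E` and any raise family `QT` of `klEngQ7`, v1 binders
  (`U ≤ klEngU₀9`, `klEngL₃ ≤ L`) — `stub_engine_scale0_klEng8_raise` (p552495) ∘ §1;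
  **`stub_engine_scale0_raise_GQ_U10L4`** — the same under the v2 binders (`U ≤ klEngU₀10 P R c`, `klEngL₄ P R β U ≤ L`);
  `stub_engine_scale0_raise_G_of_eq` — for a geometry package GIVEN as `G = klEngGeo8.raise T E` (the shape of a `CF`-re-keyed token #15 successor,
  e.g. #22's `klEngGeo9 P R` if defined through the tree's `GeoConsts.raise` with `E := klEngGeo8.cE4`).
So under #22 the v2-(a) re-closer is ONE line whatever `T` is, and under the table of record (no #22) nothing here is read.

Pure composition; no definition; nothing about the model is asserted beyond the cited upstream theorems; nothing asserts superconductivity.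
References: BGM 2006 §2–§3 [cite: BenfattoGiulianiMastropietro2006].
-/

noncomputable section

namespace Summit.HubbardSuperconductivity.HubbardSuperconductivity.Theorems.EngineV8

set_option linter.dupNamespace false -- summit = problem name (single-conjunct summit), D-0017

open Real Finset Literature.MathematicalPhysics.QuantumLattice Literature.Probability.LatticeModels
open Summit.HubbardSuperconductivity.HubbardSuperconductivity.Theorems.KLRegimeSplit
open Summit.HubbardSuperconductivity.HubbardSuperconductivity.Theorems.KLProgrammeLegKernels

/-! ## §1 The five scale-0 clauses transport along a geometry raise `G ↦ G.raise T E` -/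

section Transport

variable {L M : ℕ} [NeZero L] [NeZero M] {G : GeoConsts} {P : SplitConsts} {Q : EngConsts} {β U μ : ℝ} (T E : ℝ)

/-- **The five-clause conclusion of stub (a) transports along any geometry raise `G ↦ G.raise T E`** (`0 ≤ P.Klam`): (E1-v4)₀ does not read `G`;
(E2-F2)₀ by `pairLadderStepAtV17F2_raise_of`; (E2′-F UV)₀ by `quarticValueUVAtV17F_raise_iff`; (E4)₀ by `engineFirstMoments_raise_of` (`cE4` monotone);
(E5-F)₀ by `isoTupleL1AtV17F_raise_of` (`CF` monotone). -/
theorem scaleZeroConjV17F2_raise_of (hK : 0 ≤ P.Klam)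
    (h : KernelNormsV4 L M P Q β U μ (klFlowFrameU L M β U μ 0) 0 ∧ PairLadderStepAtV17F2 L M G P Q β U μ 0 ∧
      QuarticValueUVAtV17F L M G P Q β U μ 0 ∧ EngineFirstMoments L M G P Q β U μ (klFlowFrameU L M β U μ 0) 0 ∧
        IsoTupleL1AtV17F L M G P β U μ 0) :
    KernelNormsV4 L M P Q β U μ (klFlowFrameU L M β U μ 0) 0 ∧ PairLadderStepAtV17F2 L M (G.raise T E) P Q β U μ 0 ∧
      QuarticValueUVAtV17F L M (G.raise T E) P Q β U μ 0 ∧ EngineFirstMoments L M (G.raise T E) P Q β U μ (klFlowFrameU L M β U μ 0) 0 ∧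
        IsoTupleL1AtV17F L M (G.raise T E) P β U μ 0 :=
  ⟨h.1, pairLadderStepAtV17F2_raise_of T E h.2.1, (quarticValueUVAtV17F_raise_iff T E).2 h.2.2.1,
    engineFirstMoments_raise_of T E hK h.2.2.2.1, isoTupleL1AtV17F_raise_of T E h.2.2.2.2⟩

end Transport

/-! ## §2 Stub (a) at `(klEngGeo8.raise T E, QT P R)` — v1 and v2 binders -/

/-- **STUB (a) RAISE-GENERIC IN BOTH PACKAGES, v1 binders**: for any `T E : ℝ` and any raise family `QT` of `klEngQ7`, under `c ≤ klEngC₃6 P R`,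
`U ≤ klEngU₀9 P R c`, `klEngL₃ β U ≤ L`, `klEngM₃ β U L ≤ M`, bare flow frame admissible: (E1-v4)₀ ∧ (E2-F2)₀ ∧ (E2′-F UV)₀ ∧ (E4)₀ ∧ (E5-F)₀ at
`(klEngGeo8.raise T E, QT P R)`. -/
theorem stub_engine_scale0_raise_GQ (T E : ℝ) (QT : SplitConsts → RenConsts → EngConsts) (hQT : ∀ P R, (klEngQ7 P R).IsRaiseOf (QT P R)) :
    ∀ (P : SplitConsts) (R : RenConsts) (c : ℝ), P.WF → R.WF2 → 0 < c → c ≤ klEngC₃6 P R →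
      ∀ μ ∈ klWindowC, ∀ U : ℝ, 0 < U → U ≤ klEngU₀9 P R c → ∀ β : ℝ, klBetaMin ≤ β → β ≤ Real.exp (c / U ^ 2) →
        ∀ (L M : ℕ) [NeZero L] [NeZero M], klEngL₃ β U ≤ L → klEngM₃ β U L ≤ M →
          FrameOK R U (nScales β) μ (klFlowFrameU L M β U μ 0) →
            KernelNormsV4 L M P (QT P R) β U μ (klFlowFrameU L M β U μ 0) 0 ∧
              PairLadderStepAtV17F2 L M (klEngGeo8.raise T E) P (QT P R) β U μ 0 ∧
                QuarticValueUVAtV17F L M (klEngGeo8.raise T E) P (QT P R) β U μ 0 ∧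
                  EngineFirstMoments L M (klEngGeo8.raise T E) P (QT P R) β U μ (klFlowFrameU L M β U μ 0) 0 ∧
                    IsoTupleL1AtV17F L M (klEngGeo8.raise T E) P β U μ 0 :=
  fun P R c hP hR hc hc₆ μ hμ U hU hU₉ β hβ hβc L M _ _ hL hM hK =>
    scaleZeroConjV17F2_raise_of T E (zero_le_one.trans hP.1)
      (stub_engine_scale0_klEng8_raise QT hQT P R c hP hR hc hc₆ μ hμ U hU hU₉ β hβ hβc L M hL hM hK)

/-- **STUB (a) RAISE-GENERIC IN BOTH PACKAGES, v2 binders** (`U ≤ klEngU₀10 P R c`, `klEngL₄ P R β U ≤ L`; doors `klEngU₀10 ≤ klEngU₀9`,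
`klEngL₃ ≤ klEngL₄`). -/
theorem stub_engine_scale0_raise_GQ_U10L4 (T E : ℝ) (QT : SplitConsts → RenConsts → EngConsts)
    (hQT : ∀ P R, (klEngQ7 P R).IsRaiseOf (QT P R)) :
    ∀ (P : SplitConsts) (R : RenConsts) (c : ℝ), P.WF → R.WF2 → 0 < c → c ≤ klEngC₃6 P R →
      ∀ μ ∈ klWindowC, ∀ U : ℝ, 0 < U → U ≤ klEngU₀10 P R c → ∀ β : ℝ, klBetaMin ≤ β → β ≤ Real.exp (c / U ^ 2) →
        ∀ (L M : ℕ) [NeZero L] [NeZero M], klEngL₄ P R β U ≤ L → klEngM₃ β U L ≤ M →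
          FrameOK R U (nScales β) μ (klFlowFrameU L M β U μ 0) →
            KernelNormsV4 L M P (QT P R) β U μ (klFlowFrameU L M β U μ 0) 0 ∧
              PairLadderStepAtV17F2 L M (klEngGeo8.raise T E) P (QT P R) β U μ 0 ∧
                QuarticValueUVAtV17F L M (klEngGeo8.raise T E) P (QT P R) β U μ 0 ∧
                  EngineFirstMoments L M (klEngGeo8.raise T E) P (QT P R) β U μ (klFlowFrameU L M β U μ 0) 0 ∧
                    IsoTupleL1AtV17F L M (klEngGeo8.raise T E) P β U μ 0 :=
  fun P R c hP hR hc hc₆ μ hμ U hU hU₁₀ β hβ hβc L M _ _ hL hM hK =>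
    stub_engine_scale0_raise_GQ T E QT hQT P R c hP hR hc hc₆ μ hμ U hU (hU₁₀.trans (klEngU₀10_le_klEngU₀9 P R c)) β hβ hβc L M
      (klEngL₃_le_of_klEngL₄_le hL) hM hK

/-- **STUB (a) for a geometry family GIVEN as a raise of `klEngGeo8`** (`GT P R = klEngGeo8.raise (T P R) (E P R)`, e.g. a `CF`-re-keyed token #15
successor defined through `GeoConsts.raise`), any raise family `QT` of `klEngQ7`, v2 binders. -/
theorem stub_engine_scale0_raise_G_of_eq (GT : SplitConsts → RenConsts → GeoConsts) (T E : SplitConsts → RenConsts → ℝ)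
    (hGT : ∀ P R, GT P R = klEngGeo8.raise (T P R) (E P R)) (QT : SplitConsts → RenConsts → EngConsts)
    (hQT : ∀ P R, (klEngQ7 P R).IsRaiseOf (QT P R)) :
    ∀ (P : SplitConsts) (R : RenConsts) (c : ℝ), P.WF → R.WF2 → 0 < c → c ≤ klEngC₃6 P R →
      ∀ μ ∈ klWindowC, ∀ U : ℝ, 0 < U → U ≤ klEngU₀10 P R c → ∀ β : ℝ, klBetaMin ≤ β → β ≤ Real.exp (c / U ^ 2) →
        ∀ (L M : ℕ) [NeZero L] [NeZero M], klEngL₄ P R β U ≤ L → klEngM₃ β U L ≤ M →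
          FrameOK R U (nScales β) μ (klFlowFrameU L M β U μ 0) →
            KernelNormsV4 L M P (QT P R) β U μ (klFlowFrameU L M β U μ 0) 0 ∧
              PairLadderStepAtV17F2 L M (GT P R) P (QT P R) β U μ 0 ∧
                QuarticValueUVAtV17F L M (GT P R) P (QT P R) β U μ 0 ∧
                  EngineFirstMoments L M (GT P R) P (QT P R) β U μ (klFlowFrameU L M β U μ 0) 0 ∧
                    IsoTupleL1AtV17F L M (GT P R) P β U μ 0 := by
  intro P R c hP hR hc hc₆ μ hμ U hU hU₁₀ β hβ hβc L M _ _ hL hM hK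
  rw [hGT P R]
  exact stub_engine_scale0_raise_GQ_U10L4 (T P R) (E P R) QT hQT P R c hP hR hc hc₆ μ hμ U hU hU₁₀ β hβ hβc L M hL hM hK

end Summit.HubbardSuperconductivity.HubbardSuperconductivity.Theorems.EngineV8

end
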